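import Summits.NavierStokesRegularity.NavierStokesRegularity.Theorems.SoloSalvageLindgren2012EnstrophyTools
import Literature.Analysis.FluidPDE.NearBeltramiEnstrophyCriterion
import Literature.Analysis.FluidPDE.PineauVicolEnstrophy
import HarnessLib

/-!
# Solo salvage for claim C32 `Lindgren2012`, part 4b (cell `ns-claims`, D-0090): the slice identity
# `2∫⟪ω, ∂ₜω⟫ = 2(∫ ω·((∇×ω)×u_⊥) + ν ∫ ω·Δω)` of (21)–(25) at a fixed time, in the class

Claim skeleton: `Literature/Claims/NS/Lindgren2012.lean` (J. Lindgren, arXiv:1207.1090 v3). For a field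
`v` of the rendered class (smooth, divergence free, every derivative in `L²`, hence bounded with bounded
gradient) and a field `W` satisfying the vorticity equation at this instant,
`W + (v·∇)ω = (ω·∇)v + νΔω` (`ω = curl v`; this is `∂ₜω` along a classical solution, by the tree's
`IsVorticitySolutionOn.vorticity_eq`):

* `dissip_eq_neg_integral_frobeniusNormSq` — (27)'s «the integral is always non-positive» with its
  value: `∫⟪ω, Δω⟫ = −∫|∇ω|²_F` (Green, tree `PineauVicol2026.integral_inner_laplacian_self_eq_neg`);
* `integral_stretching_eq_stretch` — the vortex-stretching integral in the paper's form:
  `∫⟪ω, (∇v)ω⟫ = ∫⟪curl ω, v × ω⟫ = ∫ ω·((∇×ω)×v) = stretch v` (tree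
  `FarhatGrujic2018.integral_stretching_eq_integral_inner_curl_cross` + cyclicity), i.e. (15)–(21);
* `integral_two_mul_inner_curl_eq` — **the slice identity** `∫ 2⟪ω, W⟫ = 2 (stretchPerp v + ν dissip v)`
  ((14)–(25): the transport term integrates to zero — tree `integral_inner_curl_eq_of_vorticity_eq` —,
  Green for the viscous term, the Lamb form for the stretching term, `stretchPerp_eq` for (22)–(23));
* `lintegral_enorm_sq_le_of_vorticity_eq` — the `L²` bound on such a `W` (orders `1, 2, 3` of `v`;
  pressure-free), feeding the `ℓ²` balance of `ω` on a slab.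

Solo lane (`Theorems/SoloSalvage<Slug>….lean`, no item).

WHAT THIS IS NOT: not a claim about NS regularity or blow-up; not a claim about any author beyond the
typed locator.
-/

noncomputable section

set_option linter.dupNamespace false
-- nested operator types (second derivatives of slices)
set_option maxSynthPendingDepth 3

open MeasureTheory Set Filter
open _root_.Topology
open scoped ENNReal NNReal ContDiff RealInnerProductSpace Laplacian

namespace Summit.NavierStokesRegularity.NavierStokesRegularity.Theorems.Lindgren2012Salvage

open Literature.Analysis.FluidPDE Literature.Claims.NS.Ruzmaikina2008 Literature.Claims.NS.Lindgren2012

/-! ## §3 The slice identity: `2∫⟪ω, ∂ₜω⟫ = 2(stretch + ν dissip)` at a fixed time -/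

/-- **Green's identity for the vorticity in the class**: `dissip v = ∫⟪ω, Δω⟫ = −∫|∇ω|²_F`
(`ω = curl v`; `v` smooth with `Dv, D²v, D³v ∈ L²`; tree `PineauVicol2026.integral_inner_laplacian_self_eq_neg`,
its integrability side conditions supplied by the `L²` bounds on `ω, ∇ω, Δω`).
[cite: MajdaBertozziCUP2002, §3.1.1 p. 87] -/
theorem dissip_eq_neg_integral_frobeniusNormSq {v : EuclideanSpace ℝ (Fin 3) → EuclideanSpace ℝ (Fin 3)}
    (hv : ContDiff ℝ ∞ v) (h1 : ∫⁻ x, ‖iteratedFDeriv ℝ 1 v x‖ₑ ^ 2 < ⊤)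
    (h2 : ∫⁻ x, ‖iteratedFDeriv ℝ 2 v x‖ₑ ^ 2 < ⊤) (h3 : ∫⁻ x, ‖iteratedFDeriv ℝ 3 v x‖ₑ ^ 2 < ⊤) :
    dissip v = -∫ x, frobeniusNormSq (fderiv ℝ (curl v) x) := by
  set w : EuclideanSpace ℝ (Fin 3) → EuclideanSpace ℝ (Fin 3) := curl v with hw
  have hv3 : ContDiff ℝ 3 v := hv.of_le (by norm_cast)
  have hw2 : ContDiff ℝ 2 w := contDiff_curl (n := 2) (by exact hv3)
  have hw1 : ContDiff ℝ 1 w := hw2.of_le (by norm_cast)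
  have hwc : Continuous w := hw1.continuous
  have hDwc : Continuous (fderiv ℝ w) := hw1.continuous_fderiv one_ne_zero
  have hω_sq : Integrable fun x => ‖w x‖ ^ 2 :=
    (integrable_norm_curl_sq (hv.of_le (by norm_cast)) h1).1
  have hFrob : Integrable fun x => frobeniusNormSq (fderiv ℝ w x) :=
    (integrable_frobeniusNormSq_fderiv_curl hv3 h2).1
  have hDw_sq : Integrable fun x => ‖fderiv ℝ w x‖ ^ 2 :=
    hFrob.mono' (hDwc.norm.pow 2).aestronglyMeasurable (Eventually.of_forall fun x => by
      rw [Real.norm_eq_abs, abs_of_nonneg (sq_nonneg _)]; exact sq_opNorm_le_frobeniusNormSq _)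
  have hD3c : Continuous (iteratedFDeriv ℝ 3 v) := hv.continuous_iteratedFDeriv (by norm_cast)
  have hD3 : Integrable fun x => ‖iteratedFDeriv ℝ 3 v x‖ ^ 2 :=
    integrable_sq_norm_of_lintegral_lt_top hD3c h3
  have hΔc : Continuous (Δ w) := continuous_laplacian hw2
  have hΔpt : ∀ x, ‖(Δ w) x‖ ≤ 3 * ‖curlCLM‖ * ‖iteratedFDeriv ℝ 3 v x‖ := by
    intro x
    calc ‖(Δ w) x‖ ≤ 3 * ‖iteratedFDeriv ℝ 2 w x‖ :=
          norm_laplacian_le_three_mul_norm_iteratedFDeriv_two hw2 x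
      _ ≤ 3 * (‖curlCLM‖ * ‖iteratedFDeriv ℝ 3 v x‖) := by
          gcongr; exact norm_iteratedFDeriv_curl_le_opNorm_mul (N := ⊤) hv 2 le_top x
      _ = 3 * ‖curlCLM‖ * ‖iteratedFDeriv ℝ 3 v x‖ := by ring
  have hΔ_sq : Integrable fun x => ‖(Δ w) x‖ ^ 2 :=
    (hD3.const_mul ((3 * ‖curlCLM‖) ^ 2)).mono' (hΔc.norm.pow 2).aestronglyMeasurable
      (Eventually.of_forall fun x => by
        rw [Real.norm_eq_abs, abs_of_nonneg (sq_nonneg _)]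
        calc ‖(Δ w) x‖ ^ 2 ≤ (3 * ‖curlCLM‖ * ‖iteratedFDeriv ℝ 3 v x‖) ^ 2 :=
              pow_le_pow_left₀ (norm_nonneg _) (hΔpt x) 2
          _ = (3 * ‖curlCLM‖) ^ 2 * ‖iteratedFDeriv ℝ 3 v x‖ ^ 2 := by ring)
  -- the three integrability side conditions (AM–GM)
  have hD : Integrable fun y => ‖w y‖ * ‖fderiv ℝ w y‖ := by
    refine ((hω_sq.add hDw_sq).div_const 2).mono' (hwc.norm.mul hDwc.norm).aestronglyMeasurable
      (Eventually.of_forall fun x => ?_)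
    rw [Real.norm_eq_abs, abs_of_nonneg (by positivity)]
    simp only [Pi.add_apply]
    nlinarith [sq_nonneg (‖w x‖ - ‖fderiv ℝ w x‖)]
  have hL : Integrable fun y => ‖(Δ w) y‖ * ‖w y‖ := by
    refine ((hΔ_sq.add hω_sq).div_const 2).mono' (hΔc.norm.mul hwc.norm).aestronglyMeasurable
      (Eventually.of_forall fun x => ?_)
    rw [Real.norm_eq_abs, abs_of_nonneg (by positivity)]
    simp only [Pi.add_apply]
    nlinarith [sq_nonneg (‖(Δ w) x‖ - ‖w x‖)]
  have hgreen := (PineauVicol2026.integral_inner_laplacian_self_eq_neg hw2 hD hDw_sq hL).2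
  have hsymm : dissip v = ∫ x, ⟪(Δ w) x, w x⟫ := by
    unfold dissip
    exact integral_congr_ae (Eventually.of_forall fun x => real_inner_comm _ _)
  rw [hsymm, hgreen]

/-- **The stretching integral of the class in Lamb form equals the skeleton's `stretch`**:
`∫ ⟪ω, (∇v) ω⟫ = ∫ ⟪curl ω, v × ω⟫ = ∫ ⟪ω, (∇×ω) × v⟫ = stretch v` (tree
`FarhatGrujic2018.integral_stretching_eq_integral_inner_curl_cross` + cyclicity of the triple product).
[cite: MajdaBertozziCUP2002, §1.1 (vector identities)] -/
theorem integral_stretching_eq_stretch {v : EuclideanSpace ℝ (Fin 3) → EuclideanSpace ℝ (Fin 3)}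
    (hv : ContDiff ℝ ∞ v) (hdiv : VectorCalculus.IsDivFree v) {B₀ : ℝ} (hB₀ : ∀ x, ‖v x‖ ≤ B₀)
    {B₁ : ℝ} (hB₁ : ∀ x, ‖fderiv ℝ v x‖ ≤ B₁) (h1 : ∫⁻ x, ‖iteratedFDeriv ℝ 1 v x‖ₑ ^ 2 < ⊤)
    (h2 : ∫⁻ x, ‖iteratedFDeriv ℝ 2 v x‖ₑ ^ 2 < ⊤) :
    ∫ x, ⟪curl v x, fderiv ℝ v x (curl v x)⟫ = stretch v := by
  have hv2 : ContDiff ℝ 2 v := hv.of_le (by norm_cast)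
  have i1 : Integrable fun x => ‖fderiv ℝ v x‖ ^ 2 := by
    have h := integrable_sq_norm_of_lintegral_lt_top (hv.continuous_iteratedFDeriv (by norm_cast)) h1
    exact h.congr (Eventually.of_forall fun x => by simp only [norm_iteratedFDeriv_one])
  have i2 : Integrable fun x => ‖fderiv ℝ (fderiv ℝ v) x‖ ^ 2 := by
    have h := integrable_sq_norm_of_lintegral_lt_top (hv.continuous_iteratedFDeriv (by norm_cast)) h2
    refine h.congr (Eventually.of_forall fun x => ?_)
    show ‖iteratedFDeriv ℝ 2 v x‖ ^ 2 = ‖fderiv ℝ (fderiv ℝ v) x‖ ^ 2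
    rw [← norm_iteratedFDeriv_fderiv, norm_iteratedFDeriv_one]
  rw [FarhatGrujic2018.integral_stretching_eq_integral_inner_curl_cross hv2 hdiv hB₀ hB₁ i1 i2]
  unfold stretch ccurl
  exact integral_congr_ae (Eventually.of_forall fun x => inner_cross_cyclic _ _ _)

/-- **The slice identity.** For a field `v` of the class (smooth, divergence free, `Dⁿv ∈ L²`),
bounded with bounded gradient, and a field `W` satisfying the vorticity equation at this instant,
`W + (v·∇)ω = (ω·∇)v + νΔω` (`ω = curl v`): `∫ 2⟪ω, W⟫ = 2 (stretchPerp v + ν dissip v)` — the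
transport term integrates to zero, the viscous term is Green's identity, the stretching term is the
Lamb form (tree `integral_inner_curl_eq_of_vorticity_eq` + the two lemmas above + `stretchPerp_eq`).
[cite: Lindgren2012, (14)–(25) l.100–155 (print p. 2–3)] -/
theorem integral_two_mul_inner_curl_eq {ν : ℝ} {v W : EuclideanSpace ℝ (Fin 3) → EuclideanSpace ℝ (Fin 3)}
    (hv : ContDiff ℝ ∞ v) (hdiv : VectorCalculus.IsDivFree v)
    (hsob : ∀ n : ℕ, ∫⁻ x, ‖iteratedFDeriv ℝ n v x‖ₑ ^ 2 < ⊤) {B₀ : ℝ} (hB₀ : ∀ x, ‖v x‖ ≤ B₀)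
    {B₁ : ℝ} (hB₁ : ∀ x, ‖fderiv ℝ v x‖ ≤ B₁)
    (heq : ∀ x, W x + convect v (curl v) x = convect (curl v) v x + ν • (Δ (curl v)) x) :
    ∫ x, 2 * ⟪curl v x, W x⟫ = 2 * (stretchPerp v + ν * dissip v) := by
  have hv3 : ContDiff ℝ 3 v := hv.of_le (by norm_cast)
  have hid := integral_inner_curl_eq_of_vorticity_eq hv3 hdiv heq hB₀ hB₁ (hsob 1) (hsob 2) (hsob 3)
  rw [integral_const_mul, hid, stretchPerp_eq, dissip_eq_neg_integral_frobeniusNormSq hv (hsob 1)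
    (hsob 2) (hsob 3), integral_stretching_eq_stretch hv hdiv hB₀ hB₁ (hsob 1) (hsob 2)]
  ring

/-- **The `L²` bound on the time derivative of the vorticity, from the vorticity equation** (no pressure
term): if `W + (v·∇)ω = (ω·∇)v + νΔω` with `ω = curl v`, `v ∈ C³` bounded by `B₀` with gradient bounded
by `B₁`, then `∫⁻‖W‖ₑ² ≤ 3((3νκ)²‖D³v‖₂² + (B₀κ)²‖D²v‖₂² + (B₁κ)²‖Dv‖₂²)`, `κ = ‖curl‖`
(pointwise `‖W‖ ≤ 3νκ‖D³v‖ + B₀κ‖D²v‖ + B₁κ‖Dv‖`). [folklore] -/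
theorem lintegral_enorm_sq_le_of_vorticity_eq {ν : ℝ} (hν : 0 ≤ ν)
    {v W : EuclideanSpace ℝ (Fin 3) → EuclideanSpace ℝ (Fin 3)} (hv : ContDiff ℝ 3 v)
    {B₀ : ℝ} (hB₀0 : 0 ≤ B₀) (hB₀ : ∀ x, ‖v x‖ ≤ B₀) {B₁ : ℝ} (hB₁0 : 0 ≤ B₁)
    (hB₁ : ∀ x, ‖fderiv ℝ v x‖ ≤ B₁)
    (heq : ∀ x, W x + convect v (curl v) x = convect (curl v) v x + ν • (Δ (curl v)) x)
    {C₁ C₂ C₃ : ℝ≥0∞} (h1 : ∫⁻ x, ‖iteratedFDeriv ℝ 1 v x‖ₑ ^ 2 ≤ C₁)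
    (h2 : ∫⁻ x, ‖iteratedFDeriv ℝ 2 v x‖ₑ ^ 2 ≤ C₂) (h3 : ∫⁻ x, ‖iteratedFDeriv ℝ 3 v x‖ₑ ^ 2 ≤ C₃) :
    ∫⁻ x, ‖W x‖ₑ ^ 2 ≤ 3 * (ENNReal.ofReal ((ν * (3 * ‖curlCLM‖)) ^ 2) * C₃ +
      ENNReal.ofReal ((B₀ * ‖curlCLM‖) ^ 2) * C₂ + ENNReal.ofReal ((B₁ * ‖curlCLM‖) ^ 2) * C₁) := by
  set κ : ℝ := ‖curlCLM‖ with hκ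
  have hpt : ∀ x, ‖W x‖ ≤ (ν * (3 * κ)) * ‖iteratedFDeriv ℝ 3 v x‖ +
      (B₀ * κ) * ‖iteratedFDeriv ℝ 2 v x‖ + (B₁ * κ) * ‖iteratedFDeriv ℝ 1 v x‖ := by
    intro x
    have hw2 : ContDiff ℝ 2 (curl v) := contDiff_curl (n := 2) (by exact hv)
    have hWx : W x = ν • (Δ (curl v)) x - convect v (curl v) x + convect (curl v) v x := by
      have h := heq x
      have : W x = convect (curl v) v x + ν • (Δ (curl v)) x - convect v (curl v) x :=
        eq_sub_of_add_eq h
      rw [this]; abel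
    rw [hWx]
    have t1 : ‖ν • (Δ (curl v)) x‖ ≤ (ν * (3 * κ)) * ‖iteratedFDeriv ℝ 3 v x‖ := by
      rw [norm_smul, Real.norm_of_nonneg hν, mul_assoc, mul_assoc]
      refine mul_le_mul_of_nonneg_left ?_ hν
      calc ‖(Δ (curl v)) x‖ ≤ 3 * ‖iteratedFDeriv ℝ 2 (curl v) x‖ :=
            norm_laplacian_le_three_mul_norm_iteratedFDeriv_two hw2 x
        _ ≤ 3 * (κ * ‖iteratedFDeriv ℝ 3 v x‖) :=
            mul_le_mul_of_nonneg_left (norm_iteratedFDeriv_curl_le_opNorm_mul hv 2 (by norm_num) x)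
              (by norm_num)
    have t2 : ‖convect v (curl v) x‖ ≤ (B₀ * κ) * ‖iteratedFDeriv ℝ 2 v x‖ := by
      rw [convect]
      calc ‖fderiv ℝ (curl v) x (v x)‖ ≤ ‖fderiv ℝ (curl v) x‖ * ‖v x‖ :=
            ContinuousLinearMap.le_opNorm _ _
        _ ≤ (κ * ‖iteratedFDeriv ℝ 2 v x‖) * B₀ := by
            refine mul_le_mul ?_ (hB₀ x) (norm_nonneg _) (by positivity)
            rw [← norm_iteratedFDeriv_one]
            exact norm_iteratedFDeriv_curl_le_opNorm_mul hv 1 (by norm_num) x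
        _ = (B₀ * κ) * ‖iteratedFDeriv ℝ 2 v x‖ := by ring
    have t3 : ‖convect (curl v) v x‖ ≤ (B₁ * κ) * ‖iteratedFDeriv ℝ 1 v x‖ := by
      rw [convect]
      calc ‖fderiv ℝ v x (curl v x)‖ ≤ ‖fderiv ℝ v x‖ * ‖curl v x‖ := ContinuousLinearMap.le_opNorm _ _
        _ ≤ B₁ * (κ * ‖iteratedFDeriv ℝ 1 v x‖) := by
            refine mul_le_mul (hB₁ x) ?_ (norm_nonneg _) hB₁0
            have h := norm_iteratedFDeriv_curl_le_opNorm_mul hv 0 (by norm_num) x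
            rwa [norm_iteratedFDeriv_zero] at h
        _ = (B₁ * κ) * ‖iteratedFDeriv ℝ 1 v x‖ := by ring
    have e1 : ‖ν • (Δ (curl v)) x - convect v (curl v) x + convect (curl v) v x‖ ≤
        ‖ν • (Δ (curl v)) x - convect v (curl v) x‖ + ‖convect (curl v) v x‖ := norm_add_le _ _
    have e2 : ‖ν • (Δ (curl v)) x - convect v (curl v) x‖ ≤
        ‖ν • (Δ (curl v)) x‖ + ‖convect v (curl v) x‖ := norm_sub_le _ _
    linarith [e1, e2, t1, t2, t3]
  refine (lintegral_enorm_sq_le_of_norm_le_three ((hv.continuous_iteratedFDeriv le_rfl))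
    (hv.continuous_iteratedFDeriv (by norm_num)) (hv.continuous_iteratedFDeriv (by norm_num))
    (by positivity) (by positivity) (by positivity) hpt).trans ?_
  exact mul_le_mul' le_rfl (add_le_add (add_le_add (mul_le_mul' le_rfl h3)
    (mul_le_mul' le_rfl h2)) (mul_le_mul' le_rfl h1))

end Summit.NavierStokesRegularity.NavierStokesRegularity.Theorems.Lindgren2012Salvage

end
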